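import Summits.QuantumFields.YangMills.Theorems.AlphaInputsT3ACv3LinearLiftSpreadLip
import Summits.QuantumFields.YangMills.Theorems.AlphaInputsT3ACv3LinearLiftTorus
import HarnessLib

/-!
# `AlphaInputsT3ACv3LinearLiftTorusLip` — (LL) STEP L4-Lip: THE SMOOTH EXACT LINEAR LIFT ON THE FULL TORUS — exact `k`-fold (0.4)-linear averages, fine curls
# `≤ 54^d·ε/(L^k)²` AND LIPSCHITZ AT SCALE `L^k`: `|curl a(x + e_λ) − curl a(x)| ≤ 330·54^{d−1}·ε/(L^k)³` — cell `ym3-torus`, width seat `ym3-torus-px19` (g3),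
# line «SYM-CENTRE» row (R3) (LOCATE #56 of seat px20 g2 §6; GO 2026-08-28T22:03:47Z)

By-name twin of `AlphaInputsT3ACv3LinearLiftBiorth` + `…LinearLiftTorus` (seat `ym-ust-19936-w2` g0) with the Lipschitz spreading `S1L`/`S2L` of `…SpreadLip`:
* §1 `runSum_S1L`, `blockSum_profilesL`, ★★ `segIter_S1L : segIter k (S1L k A) = A` (biorthogonality: `PtauL_seg` in the run direction, `PsigL_cell` across);
* §2 `liftL k A := S1L k A − d(−Ψ_k(S1L k A) ∘ coarsen_k)`, ★★ `linAvgIter_liftL : linAvgIter k (liftL k A) = A` (EXACT), ★★ `curlAt_liftL : curlAt (liftL k A) x μ ν = S2L k (curlAt A) x μ ν`;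
* §3 ★★★ `exists_smoothExactLift_torus`: every coarse one-form `A` on `T^{(k)}` with `|curlAt A| ≤ ε` is the EXACT `k`-fold (0.4)-linear average of a finest one-form `a` with
  `|curlAt a x μ ν| ≤ 54^d·ε/(L^k)²` AND `|curlAt a (x + e_λ) μ ν − curlAt a x μ ν| ≤ 330·54^{d−1}·ε/(L^k)³` for every direction `λ` — both clauses of a regular representative
  (`T3PrintedRegularMinimiser.RegPr`: plaquettes `∝ η²`, divergence `∝ η³`, `η = L^{−k}`) at the right exponents; the landed step-profile lift `exists_linearLift_torus` has the
  first clause only (LOCATE #56 (V5): its `∂*curl` is `∝ η²`).  Constants crude-absolute (radius LETTER `CS` of the EX display, RULING ★w2-19200 g6 2026-08-28T22:08:41Z).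
Generic lemmas (`sum_cellFin_fin`, `linAvgIter_sub`, `iterBlockOf_toFine`, `dgrad_neg'`, `curlAt_sub`, `curlAt_dgrad`, `linAvgIter_eq_segIter_sub`, `linAvgIter_dgrad`) REUSED BY NAME.
HONEST FRAMING.  Lattice bookkeeping; nothing of [Balaban1987RG1]∕[Balaban1985Variational] asserted; count-neutral helper toward the symmetric-centre row of the EX display
(`--supports stmt-QuantumFields-19200`); registry untouched.  YM₃ on the torus is a RUNG of the programme, not the Clay problem; no claim about d = 4, infinite volume or a mass gap.

References: T. Bałaban, Commun. Math. Phys. 109 (1987) 249–301 [Balaban1987RG1] ((0.4)+(0.11) p.253); Commun. Math. Phys. 102 (1985) 277–309 [Balaban1985Variational]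
(Thm 1 (8) p.279: the regularity window `B₃ε₁L^{−2j}` incl. the divergence clause the lift must meet).
-/

set_option autoImplicit false

noncomputable section

namespace Summit.QuantumFields.YangMills.Theorems.LinearLiftSpreadLip

open Finset
open Literature.MathematicalPhysics.QuantumFieldTheory.Balaban1983to89
open Literature.MathematicalPhysics.QuantumFieldTheory.Balaban1983to89.BlockAveragingEMLProp2 (shiftN_apply shift_shift_comm)
open Literature.MathematicalPhysics.QuantumFieldTheory.Balaban1983to89.B10Eq47AxialChi (shiftN)
open Literature.MathematicalPhysics.QuantumFieldTheory.Balaban1983to89.B5Eq118OneStroke (iterBlock mem_iterBlock_iff iterBlockOf iterBlockOf_zero iterBlockOf_succ)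
open Literature.MathematicalPhysics.QuantumFieldTheory.Balaban1983to89.B5Eq117TorusCarriers (blockSiteK sum_iterBlock_eq)
open Literature.MathematicalPhysics.QuantumFieldTheory.Balaban1983to89.B10Eq38TorusDomains (toFine toFine_zero toFine_succ)
open Summit.QuantumFields.YangMills.Theorems.AbelianEML (runSum linAvgIter linAvg04 linAvgIter_succ curlAt)
open Summit.QuantumFields.YangMills.Theorems.LinearLiftProfile
open Summit.QuantumFields.YangMills.Theorems.LinearLiftProfileLip
open Summit.QuantumFields.YangMills.Theorems.LinearLiftGauge (dgrad segIter segIter_apply psiIter linAvgIter_eq_segIter_sub linAvgIter_dgrad linAvg04_sub)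
open Summit.QuantumFields.YangMills.Theorems.LinearLiftSpread (hh hside hN shift_bijective sum_shift sum_cellFin_fin linAvgIter_sub iterBlockOf_toFine dgrad_neg' curlAt_sub curlAt_dgrad)
open Summit.QuantumFields.Balaban3D.Carriers (shift_apply_self shift_apply_ne)

variable {P : Params} (k : ℕ) (hk : k ≤ P.m + P.K)

/-! ## §1 Biorthogonality -/

/-- **A STRAIGHT RUN OF THE SPREAD 1-FORM**: `Σ_{m<L^k} (S1L k A)(x + m e_μ, μ) = Σ_y A(y, μ) · (Σ_m Pτ(x_μ + m, y_μ)) · Π_{i ≠ μ} Pσ(x_i, y_i)` (the run moves only the `μ`-coordinate).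
[cite: Balaban1987RG1, (0.4) p.253] -/
theorem runSum_S1L (A : PBond P k → ℝ) (x : Site P 0) (μ : Fin P.d) :
    runSum (S1L k A) x μ (P.L ^ k) = ∑ y : Site P k, A ⟨y, μ⟩ *
      ((∑ m ∈ range (P.L ^ k), PtauL (hh P k) (x μ + ((m : ℕ) : ZMod (P.sitesPerDir 0))) (y μ)) * ∏ i ∈ univ.erase μ, PsigL (hh P k) (x i) (y i)) := by
  unfold runSum S1L
  rw [sum_comm]
  refine sum_congr rfl fun y _ => ?_
  rw [sum_mul, mul_sum]
  refine sum_congr rfl fun m _ => ?_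
  dsimp only
  rw [shiftN_apply, if_pos rfl]
  congr 2
  exact prod_congr rfl fun i hi => by rw [shiftN_apply, if_neg (ne_of_mem_erase hi), add_zero]

/-! ## §2 Biorthogonality -/

include hk in
/-- The block sum of the run-direction `τ`-sums times the transverse `σ`-profiles factorises and evaluates: `n^d` if `y = z`, else `0`. [folklore] -/
theorem blockSum_profilesL (z y : Site P k) (μ : Fin P.d) :
    ∑ x ∈ iterBlock k z, (∑ m ∈ range (P.L ^ k), PtauL (hh P k) (x μ + ((m : ℕ) : ZMod (P.sitesPerDir 0))) (y μ)) * ∏ i ∈ univ.erase μ, PsigL (hh P k) (x i) (y i)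
      = if y = z then ((side (hh P k) : ℝ)) ^ P.d else 0 := by
  have hN' := hN k hk
  -- the summand as a product over all coordinates
  let g : Fin P.d → ZMod (P.sitesPerDir 0) → ℝ := fun i a =>
    if i = μ then ∑ m ∈ range (P.L ^ k), PtauL (hh P k) (a + ((m : ℕ) : ZMod (P.sitesPerDir 0))) (y i) else PsigL (hh P k) a (y i)
  have hg : ∀ x : Site P 0, (∑ m ∈ range (P.L ^ k), PtauL (hh P k) (x μ + ((m : ℕ) : ZMod (P.sitesPerDir 0))) (y μ)) * ∏ i ∈ univ.erase μ, PsigL (hh P k) (x i) (y i)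
      = ∏ i, g i (x i) := by
    intro x
    rw [← mul_prod_erase univ (fun i => g i (x i)) (mem_univ μ)]
    simp only [g, if_pos rfl]
    congr 1
    exact prod_congr rfl fun i hi => by rw [if_neg (ne_of_mem_erase hi)]
  rw [sum_congr rfl fun x _ => hg x, sum_iterBlock_eq hk]
  -- parametrise the block by the corner offsets and factorise over the coordinates
  let G : Fin P.d → Fin (P.L ^ k) → ℝ := fun i t => g i ((((z i).val * P.L ^ k + (t : ℕ) : ℕ)) : ZMod (P.sitesPerDir 0))
  have hG : ∀ jj : Fin P.d → Fin (P.L ^ k), ∏ i, g i (blockSiteK k z jj i) = ∏ i, G i (jj i) := fun jj => rfl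
  rw [sum_congr rfl fun jj _ => hG jj]
  have hfac : ∑ jj : Fin P.d → Fin (P.L ^ k), ∏ i, G i (jj i) = ∏ i, ∑ t : Fin (P.L ^ k), G i t := by
    rw [Finset.prod_univ_sum, Fintype.piFinset_univ]
  rw [hfac]
  have hcell : ∀ i, ∑ t : Fin (P.L ^ k), G i t = ∑ a ∈ cellFin (hh P k) (z i), g i a :=
    fun i => (sum_cellFin_fin (hh P k) hN' (P.L ^ k) (hside k) (g i) (z i)).symm
  rw [prod_congr rfl fun i _ => hcell i]
  -- each coordinate sum
  have hi : ∀ i, ∑ a ∈ cellFin (hh P k) (z i), g i a = if y i = z i then (side (hh P k) : ℝ) else 0 := by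
    intro i
    by_cases h : i = μ
    · simp only [g, if_pos h]
      rw [← hside (P := P) k]
      exact PtauL_seg (hh P k) hN' (y i) (z i)
    · simp only [g, if_neg h]
      exact PsigL_cell (hh P k) hN' (y i) (z i)
  rw [prod_congr rfl fun i _ => hi i]
  by_cases hyz : y = z
  · subst hyz
    simp only [if_true]
    rw [prod_const, card_univ, Fintype.card_fin]
  · rw [if_neg hyz]
    obtain ⟨i, hi'⟩ : ∃ i, y i ≠ z i := Function.ne_iff.mp hyz
    exact prod_eq_zero (mem_univ i) (if_neg hi')

include hk in
/-- **★★ BIORTHOGONALITY**: `segIter k (S1L k A) = A` — the `k`-fold transported-segment mean of the spread of a coarse 1-form returns the 1-form EXACTLY (flat formula, product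
structure of the block, `PtauL_seg` in the run direction, `PsigL_cell` across). [cite: Balaban1987RG1, (0.4)+(0.11) p.253] -/
theorem segIter_S1L (A : PBond P k → ℝ) : segIter k (S1L k A) = A := by
  funext c
  obtain ⟨z, μ⟩ := c
  rw [segIter_apply (S1L k A) k hk z μ]
  simp_rw [runSum_S1L]
  rw [sum_comm]
  simp_rw [← mul_sum]
  simp_rw [blockSum_profilesL k hk z _ μ, mul_ite, mul_zero]
  rw [sum_ite_eq']
  simp only [mem_univ, if_true]
  rw [show (side (hh P k) : ℝ) = (P.L : ℝ) ^ k by rw [hside]; push_cast; ring]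
  have hn : (0 : ℝ) < ((P.L : ℝ) ^ k) ^ P.d := pow_pos (pow_pos (Nat.cast_pos.mpr P.L_pos) _) _
  field_simp


/-! ## §2 The lift -/

/-- **THE EXACT LINEAR LIFT** of a coarse one-form `A` on `T^{(k)}` to the finest torus: the spread `S1L k A` corrected by the pure gauge `d(Ψ_k(S1L k A) ∘ coarsen_k)` that absorbs
the (0.4) coboundary. [cite: Balaban1987RG1, (0.4)+(0.11) p.253] -/
def liftL (k : ℕ) (A : PBond P k → ℝ) : PBond P 0 → ℝ :=
  S1L k A - dgrad (fun x => -psiIter k (S1L k A) (iterBlockOf k x))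

include hk in
/-- **★★ EXACTNESS**: `linAvgIter k (liftL k A) = A` — the `k`-fold (0.4)-linear average of the lift IS the coarse one-form. [cite: Balaban1987RG1, (0.4)+(0.11) p.253] -/
theorem linAvgIter_liftL (A : PBond P k → ℝ) : linAvgIter k (liftL k A) = A := by
  unfold liftL
  rw [linAvgIter_sub, linAvgIter_eq_segIter_sub, segIter_S1L k hk, linAvgIter_dgrad]
  have e : ((fun x : Site P 0 => -psiIter k (S1L k A) (iterBlockOf k x)) ∘ toFine k) = fun y => -psiIter k (S1L k A) y := by
    funext y; simp only [Function.comp, iterBlockOf_toFine k hk y]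
  rw [e, dgrad_neg']
  funext b
  simp only [Pi.sub_apply]
  ring

include hk in
/-- **★★ THE CURL OF THE LIFT IS THE SPREAD OF THE COARSE CURL**: `curlAt (liftL k A) x μ ν = S2L k (curlAt A) x μ ν` (`μ ≠ ν`). [cite: Balaban1987RG1, (0.4) p.253] -/
theorem curlAt_liftL (A : PBond P k → ℝ) (x : Site P 0) {μ ν : Fin P.d} (hμν : μ ≠ ν) :
    curlAt (liftL k A) x μ ν = S2L k (fun y μ' ν' => curlAt A y μ' ν') x μ ν := by
  unfold liftL
  rw [curlAt_sub, curlAt_dgrad, sub_zero, curlAt_S1L k hk A x hμν]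

/-! ## §3 The smooth exact lift -/

include hk in
/-- **★★★ (R3) THE SMOOTH EXACT LINEAR LIFT ON THE FULL TORUS**: every coarse one-form `A` on `T^{(k)}` whose lattice curls are bounded by `ε` is the EXACT `k`-fold
(0.4)-linear average of a finest one-form whose lattice curls are bounded by `54^d · ε / (L^k)²` AND are LIPSCHITZ AT SCALE `L^k`:
`|curlAt a (x + e_λ) μ ν − curlAt a x μ ν| ≤ 330 · 54^{d−1} · ε / (L^k)³` for every direction `λ` (so `|∂*curl a| ≤ 4·330·54^{d−1}·ε/(L^k)³`: both clauses of a regular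
representative at the right exponents `η²`, `η³`, `η = L^{−k}`). [cite: Balaban1987RG1, (0.4)+(0.11) p.253; Balaban1985Variational, Thm 1 (8) p.279] -/
theorem exists_smoothExactLift_torus (A : PBond P k → ℝ) {ε : ℝ} (hA : ∀ (y : Site P k) (μ ν : Fin P.d), μ ≠ ν → |curlAt A y μ ν| ≤ ε) :
    ∃ a : PBond P 0 → ℝ, linAvgIter k a = A ∧
      (∀ (x : Site P 0) (μ ν : Fin P.d), μ ≠ ν → |curlAt a x μ ν| ≤ (54 : ℝ) ^ P.d * ε / ((P.L : ℝ) ^ k) ^ 2) ∧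
      (∀ (x : Site P 0) (lam μ ν : Fin P.d), μ ≠ ν →
        |curlAt a (x.shift lam) μ ν - curlAt a x μ ν| ≤ 330 * (54 : ℝ) ^ (P.d - 1) * ε / ((P.L : ℝ) ^ k) ^ 3) := by
  refine ⟨liftL k A, linAvgIter_liftL k hk A, fun x μ ν hμν => ?_, fun x lam μ ν hμν => ?_⟩
  · rw [curlAt_liftL k hk A x hμν]
    exact abs_S2L_le k (fun y μ' ν' => curlAt A y μ' ν') x hμν fun y => hA y μ ν hμν
  · rw [curlAt_liftL k hk A (x.shift lam) hμν, curlAt_liftL k hk A x hμν]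
    exact abs_S2L_shift_sub_le k hk (fun y μ' ν' => curlAt A y μ' ν') x hμν lam fun y => hA y μ ν hμν

end Summit.QuantumFields.YangMills.Theorems.LinearLiftSpreadLip

end
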